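import Mathlib
import Literature.NumberTheory.Automorphic.QuaternionAlgebraAdelic
import Literature.NumberTheory.Automorphic.BrandtXi
import Literature.NumberTheory.Automorphic.HyperbolicLaplaceSpectrum
import Literature.NumberTheory.EllipticCurves.ModularCurve
import Literature.NumberTheory.EllipticCurves.GlobalMinimalModel
import HarnessLib

/-!
# Shimura curves `X₀^D(M)` over `ℚ`: the complex-analytic vocabulary
# (Pasten, *Shimura curves and the abc conjecture*, §§2, 4, 5, 8; Vignéras LNM 800, Ch. IV)

Definitions only (the named facts are in `ShimuraCurveRibetTakahashi.lean`), for route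
`ABC/RibetTakahashiSplit` (definition item `defn-ShimuraCurveIntegralForms`, statement item
`EigenformLowerBound`, and the Jacquet–Langlands package of the crux `ManyPrimeValuationProduct`,
line `jl-zero-cycle-height`). Sources: H. Pasten, J. Number Theory 254 (2024) 214–335 =
arXiv:1705.09251 [PastenShimura2024], read in the arXiv version (§2 p. 12, §4 pp. 14–16, §5
p. 17, §8 p. 29, §16 p. 49); M.-F. Vignéras, LNM 800 [VignerasLNM800], Ch. IV §§1–3.

For an *admissible factorisation* `N = D M` (§2 p. 12) the Shimura curve `X₀^D(M)/ℚ` is attached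
to an Eichler order `O` of level `M` in the quaternion algebra `B/ℚ` of discriminant `D` (§4.1).
As `ω(D)` is even, `B` is indefinite; a real splitting `ι : B ↪ M₂(ℝ)` identifies the norm-one
units `O¹` with a Fuchsian group `Γ₀^D(M) ≤ SL₂(ℝ)`, `X₀^D(M)(ℂ) = Γ₀^D(M)\ℍ` (§4.3, §4.7: for
`U = U₀^D(M)` the class group `C(U)` is trivial and `Γ_U = O¹`), compact for `D > 1` (no cusps,
§1 p. 5), and `S₂^D(M)` is Mathlib's `CuspForm Γ 2`, `Γ ≤ GL(2, ℝ)` (the cusp condition is vacuous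
for `D > 1`: a cocompact group has no parabolic elements, so `IsCusp c Γ` never holds).

## Contents (namespace `Literature.NumberTheory.Automorphic`)

* `IsAdmissibleFactorization N D M` (§2 p. 12).
* `normOneUnits ι hO ≤ GL(2, ℝ)`: the group `ι(O¹)` of an order `O` (tree `Brandt.IsOrder`) under
  a real representation `ι` — matrices `g` with `g, g⁻¹ ∈ ι(O)`, `det g = 1` (a `Subgroup`;
  `HasDetOne`; `-1 ∈ Γ`).
* `ShimuraCurveData D M`: `B/ℚ` ramified exactly at the primes of the squarefree `D` (tree
  `IsQuaternionAlgebra`, `ramifiedPlaces`), an Eichler order `O` of level `M` (tree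
  `Brandt.IsEichlerOrder`: `O = O₁ ∩ O₂`, `[O₁ : O] = M`), an injective `ι : B →ₐ[ℚ] M₂(ℝ)` and a
  measurable fundamental domain `fd` of `Γ = ι(O¹)` on `ℍ` (tree `IsHypFundamentalDomain`, the
  a.e. notion, correct when `-1 ∈ Γ`) — the INDEFINITE twin of the definite `Brandt.XiSetup`;
  `X.Gamma = Γ₀^D(M)`.
* `peterssonNormSq F h = ∫_F |h|² (Im z)² dμ` (`μ` = Mathlib's `volume` `dx dy/y²` on `ℍ`),
  `X.normSq`, `X.norm` = Pasten's un-normalised `‖h‖_{U,2}` (§4.6 p. 15, §8.1 p. 29);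
  `hypSupNorm h = sup |h| Im z` (§8.1).
* `segmentIntegral s z w = ∫_z^w s dτ`, `HasPeriodsIn Γ s Λ` (the periods `∫_z^{γz} s` lie in `Λ`).
* `X.heckeSet n = ι(O(n))`, `X.heckeSetoid n` (left `Γ`-cosets), `X.heckeFun n h =
  Σ_{[α] ∈ Γ\ι(O(n))} h ∣[2] α` = the classical `T_n` in weight `2` (Eichler; Shimura 1971 §3.3;
  Pasten §4.8 for `n` coprime to `D M`), arithmetically normalised by Mathlib's slash action
  `(h ∣[2] α)(τ) = det α · j(α,τ)⁻² h(ατ)` (so `T_ℓ` has eigenvalue `a_ℓ` on the transfer of a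
  normalised newform).
* `ShimuraParametrizationData X W` — the Shimura analogue of the tree's
  `ModularParametrizationData W N` (same design): lattice `L` of the invariant differential of the
  model `W` (`IsNeronLatticeOf`), the uniformisation `ℂ →+ W(ℂ)` with kernel `Λ_L` (honest
  hypothesis fields, as there), and a non-constant holomorphic map `Γ\ℍ → W(ℂ)` recorded by its
  pulled-back form `form` (`φ^•(du) = form dτ`), a base point, the period condition, the Hecke
  condition `T_ℓ form = a_ℓ(W) form` (`ℓ ∤ D M` prime; pins the Jacquet–Langlands line of `W`,
  §4.9–4.11) and the degree `deg` with its fibre count `deg_spec`. Derived: `φ`. (`IsMinimalFor` — the datum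
  realises Pasten's `δ_{D,M}(E)` — and `IsFreyHellegouarch` are in the facts file.)

## Design notes

* Complex-analytic throughout; the canonical model over `ℚ`, `J₀^D(M)`, Néron models and the
  integral structure `𝒮₂^D(M)` (Pasten §1 p. 5) are NOT defined here (the route's statements consume
  only norms, periods and degrees); optimal quotients enter only through minimal degrees, as `δ_{1,N}`
  does in `Literature.NumberTheory.EllipticCurves.ModularForms.PastenShimura2024_thm_5_5`.
  Existence of data is a named fact (`nonempty_shimuraCurveData`), never a field.
* Junk values: `hypSupNorm = 0` for unbounded `|h| Im`; `heckeFun` is a `finsum` over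
  `Quotient.out` representatives (finite coset space — Eichler; for `Γ`-invariant `h` of weight
  `2` the summands do not depend on representatives: `h ∣[2] (γα) = (h ∣[2] γ) ∣[2] α`).
* `lean search`: no Shimura curve, Eichler unit group, quaternionic Hecke operator or Petersson
  norm for non-arithmetic `Γ` in Mathlib/tree (the tree's `peterssonProduct` needs
  `Subgroup.IsArithmetic`, false for `D > 1`); used: `CuspForm`, `SlashAction`, `UpperHalfPlane`
  and its `volume`, `PeriodPair`, `WeierstrassCurve.LFunction`, `Subgroup.HasDetOne`,
  `Brandt.IsEichlerOrder`, `IsHypFundamentalDomain`.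

## References

* H. Pasten, *Shimura curves and the abc conjecture*, J. Number Theory 254 (2024) =
  arXiv:1705.09251: §2 p. 12, §3 p. 13, §4 pp. 14–16, §5.1–5.3 p. 17, §8.1 p. 29. [PastenShimura2024]
* M.-F. Vignéras, *Arithmétique des algèbres de quaternions*, LNM 800 (1980), Ch. IV §§1–3.
  [VignerasLNM800]
* K. A. Ribet, S. Takahashi, PNAS 94 (1997) 11110–11114. [RibetTakahashi1997]
* G. Shimura, *Introduction to the arithmetic theory of automorphic functions* (1971), §3.3, Ch. 9.
-/
noncomputable section

open scoped MatrixGroups ModularForm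
open _root_.MeasureTheory UpperHalfPlane NumberField IsDedekindDomain

namespace Literature.NumberTheory.Automorphic

open Literature.NumberTheory.EllipticCurves.ModularForms (IsNeronLatticeOf)

/-! ### Admissible factorisations -/

/-- **Admissible factorisation** `N = D M` (Pasten §2 p. 12: "`D, M` are coprime positive
integers with `D` being the product of an even number of distinct prime factors, possibly
`D = 1`"): `N > 0`, `D M = N`, `D` squarefree with `ω(D)` even, `gcd(D, M) = 1`.
[cite: PastenShimura2024, §2 p. 12 (admissible factorization)] -/
structure IsAdmissibleFactorization (N D M : ℕ) : Prop where
  /-- `N` is a positive integer. -/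
  pos : 0 < N
  /-- `N = D M`. -/
  mul_eq : D * M = N
  /-- `D` is squarefree … -/
  squarefree : Squarefree D
  /-- … with an even number of prime factors. -/
  even_card_primeFactors : Even D.primeFactors.card
  /-- `D` and `M` are coprime. -/
  coprime : Nat.Coprime D M

namespace IsAdmissibleFactorization

variable {N D M : ℕ}

/-- `D > 0` for an admissible factorisation. [folklore] -/
theorem pos_left (h : IsAdmissibleFactorization N D M) : 0 < D :=
  Nat.pos_of_mul_pos_right (h.mul_eq ▸ h.pos)

/-- `M > 0` for an admissible factorisation. [folklore] -/
theorem pos_right (h : IsAdmissibleFactorization N D M) : 0 < M :=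
  Nat.pos_of_mul_pos_left (h.mul_eq ▸ h.pos)

end IsAdmissibleFactorization

/-- The classical factorisation `N = 1 · N` is admissible (Pasten §2 p. 12, "possibly `D = 1`").
[folklore] -/
theorem isAdmissibleFactorization_one {N : ℕ} (hN : 0 < N) : IsAdmissibleFactorization N 1 N :=
  ⟨hN, one_mul N, squarefree_one, by simp, Nat.coprime_one_left N⟩

/-! ### The Fuchsian group `ι(O¹)` of an order -/

section NormOne

variable {B : Type*} [Ring B] [Algebra ℚ B]

/-- **The norm-one group `Γ = ι(O¹)` of an order** `O ⊆ B` under a real representation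
`ι : B → M₂(ℝ)`: the invertible real matrices `g` with `g ∈ ι(O)`, `g⁻¹ ∈ ι(O)` and `det g = 1`
(i.e. the image of the units of `O` of reduced norm `1`; for `x ∈ O` with `nrd x = 1` the inverse
`x̄ = trd(x) − x` lies in `O` automatically, so the second condition is redundant but makes the
subgroup axioms formal). For `B` indefinite over `ℚ`, `ι` injective and `O` an Eichler order of
level `M` this is `Γ₀^D(M)` (Vignéras IV §1; Pasten §4.3/§4.7: `Γ_{U₀^D(M)} = O¹`).
[cite: VignerasLNM800, Ch. IV §1 (groupes de quaternions)] -/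
def normOneUnits (ι : B →ₐ[ℚ] Matrix (Fin 2) (Fin 2) ℝ) {O : Submodule ℤ B}
    (hO : Brandt.IsOrder B O) : Subgroup (GL (Fin 2) ℝ) where
  carrier := {g | (∃ x ∈ O, ι x = (g : Matrix (Fin 2) (Fin 2) ℝ)) ∧
    (∃ y ∈ O, ι y = ((g⁻¹ : GL (Fin 2) ℝ) : Matrix (Fin 2) (Fin 2) ℝ)) ∧ g.det = 1}
  one_mem' := ⟨⟨1, hO.one_mem, by simp⟩, ⟨1, hO.one_mem, by simp⟩, map_one _⟩
  mul_mem' := by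
    rintro g g' ⟨⟨x, hx, hxg⟩, ⟨y, hy, hyg⟩, hg⟩ ⟨⟨x', hx', hxg'⟩, ⟨y', hy', hyg'⟩, hg'⟩
    refine ⟨⟨x * x', hO.mul_mem x hx x' hx', ?_⟩, ⟨y' * y, hO.mul_mem y' hy' y hy, ?_⟩, ?_⟩
    · rw [map_mul, hxg, hxg', Units.val_mul]
    · rw [map_mul, hyg, hyg', mul_inv_rev, Units.val_mul]
    · rw [map_mul, hg, hg', mul_one]
  inv_mem' := by
    rintro g ⟨hx, hy, hg⟩
    exact ⟨hy, by simpa only [inv_inv] using hx, by rw [map_inv, hg, inv_one]⟩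

variable (ι : B →ₐ[ℚ] Matrix (Fin 2) (Fin 2) ℝ) {O : Submodule ℤ B} (hO : Brandt.IsOrder B O)

/-- Membership in `ι(O¹)` (definitional). [folklore] -/
theorem mem_normOneUnits_iff {g : GL (Fin 2) ℝ} :
    g ∈ normOneUnits ι hO ↔ (∃ x ∈ O, ι x = (g : Matrix (Fin 2) (Fin 2) ℝ)) ∧
      (∃ y ∈ O, ι y = ((g⁻¹ : GL (Fin 2) ℝ) : Matrix (Fin 2) (Fin 2) ℝ)) ∧ g.det = 1 :=
  Iff.rfl

/-- `ι(O¹) ≤ SL₂(ℝ)` (Mathlib `Subgroup.HasDetOne`, so that `CuspForm (normOneUnits ι hO) k` is a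
`ℂ`-module). An instance on this file's own definition; no Mathlib instance is overridden.
[folklore] -/
instance hasDetOne_normOneUnits : (normOneUnits ι hO).HasDetOne :=
  ⟨fun hg => hg.2.2⟩

/-- `-1 ∈ ι(O¹)` (as `-1 ∈ O`); so `Γ` acts on `ℍ` through `Γ/{±1}`. [folklore] -/
theorem neg_one_mem_normOneUnits : -1 ∈ normOneUnits ι hO := by
  refine ⟨⟨-1, O.neg_mem hO.one_mem, by simp⟩, ⟨-1, O.neg_mem hO.one_mem, by simp⟩, ?_⟩
  ext
  simp [Matrix.det_neg]

end NormOne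

/-! ### Shimura curve data of level `(D, M)` -/

/-- **Shimura curve data of level `(D, M)`** — the analytic presentation of `X₀^D(M)`: a
quaternion algebra `B/ℚ` (tree `IsQuaternionAlgebra`) ramified exactly at the primes dividing the
squarefree integer `D` (`ramifiedPlaces`; finite places of `ℚ` = primes via Mathlib's
`Rat.HeightOneSpectrum.primesEquiv`), an Eichler order `O` of level `M` (tree
`Brandt.IsEichlerOrder`), an injective `ℚ`-algebra map `ι : B → M₂(ℝ)` (a real splitting: it exists
iff `B` is indefinite, i.e. `ω(D)` even) and a measurable fundamental domain `fd` for the action of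
`Γ₀^D(M) = ι(O¹)` on `ℍ` (`IsHypFundamentalDomain`). Then `X₀^D(M)(ℂ) = Γ₀^D(M)\ℍ` (Pasten §4.1,
§4.3, §4.7; Vignéras IV §1). The indefinite twin of `Brandt.XiSetup`. Existence for admissible
`(D M, D, M)` is the named fact `nonempty_shimuraCurveData`, not a field. [cite: PastenShimura2024, §4.1 and §4.7 (pp. 14–15)] -/
structure ShimuraCurveData (D M : ℕ) : Type 1 where
  /-- The quaternion algebra. -/
  B : Type
  [instRing : Ring B]
  [instAlgebra : Algebra ℚ B]
  [isQuaternionAlgebra : IsQuaternionAlgebra ℚ B]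
  /-- `D` is squarefree … -/
  squarefree : Squarefree D
  /-- … and `B` is ramified exactly at the primes dividing `D`: `disc B = D`. -/
  ramifiedPlaces_eq : ramifiedPlaces ℚ B =
    {v | ((Rat.HeightOneSpectrum.primesEquiv v : Nat.Primes) : ℕ) ∣ D}
  /-- The Eichler order. -/
  O : Submodule ℤ B
  /-- `O` is an Eichler order of level `M`. -/
  isEichlerOrder : Brandt.IsEichlerOrder B O M
  /-- The real splitting `B → M₂(ℝ)`. -/
  ι : B →ₐ[ℚ] Matrix (Fin 2) (Fin 2) ℝ
  /-- `ι` is injective. -/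
  ι_injective : Function.Injective ι
  /-- A fundamental domain for `Γ₀^D(M)` acting on `ℍ`. -/
  fd : Set ℍ
  /-- `fd` is a measurable, a.e.-exact fundamental domain. -/
  isFundamentalDomain_fd : IsHypFundamentalDomain (normOneUnits ι isEichlerOrder.isOrder) fd

namespace ShimuraCurveData

variable {D M : ℕ}

/-- The ring structure of the algebra of a datum. [folklore] -/
instance instRingB (X : ShimuraCurveData D M) : Ring X.B := X.instRing

/-- The `ℚ`-algebra structure of the algebra of a datum. [folklore] -/
instance instAlgebraB (X : ShimuraCurveData D M) : Algebra ℚ X.B := X.instAlgebra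

/-- The algebra of a datum is a quaternion algebra over `ℚ`. [folklore] -/
instance isQuaternionAlgebraB (X : ShimuraCurveData D M) : IsQuaternionAlgebra ℚ X.B :=
  X.isQuaternionAlgebra

/-- The Eichler order of a datum is an order. [folklore] -/
theorem isOrder (X : ShimuraCurveData D M) : Brandt.IsOrder X.B X.O := X.isEichlerOrder.isOrder

/-- **`Γ₀^D(M)`** `= ι(O¹) ≤ GL(2, ℝ)`, the level of the datum (Pasten §4.3/§4.7). [cite: PastenShimura2024, §4.3 and §4.7 (pp. 14–15)] -/
def Gamma (X : ShimuraCurveData D M) : Subgroup (GL (Fin 2) ℝ) := normOneUnits X.ι X.isOrder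

/-- `Γ₀^D(M) ≤ SL₂(ℝ)`. [folklore] -/
instance hasDetOne_Gamma (X : ShimuraCurveData D M) : X.Gamma.HasDetOne :=
  hasDetOne_normOneUnits X.ι X.isOrder

/-- `-1 ∈ Γ₀^D(M)`. [folklore] -/
theorem neg_one_mem_Gamma (X : ShimuraCurveData D M) : -1 ∈ X.Gamma :=
  neg_one_mem_normOneUnits X.ι X.isOrder

/-- The field `fd` is a fundamental domain of `X.Gamma`. [folklore] -/
theorem isHypFundamentalDomain_fd (X : ShimuraCurveData D M) : IsHypFundamentalDomain X.Gamma X.fd :=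
  X.isFundamentalDomain_fd

end ShimuraCurveData

/-! ### Norms of weight-two forms -/

/-- The **un-normalised Petersson norm** `‖h‖²_{F} = ∫_F |h(z)|² (Im z)² dμ(z)` of a function on
`ℍ` over a set `F` (a fundamental domain), `μ` Mathlib's invariant measure `dx dy/y²` (Pasten §4.6
p. 15: `⟨h₁,h₂⟩_{U,a} = ∫_{Γ\ℍ} h₁ h̄₂ Im(z)² dμ`, "non-normalized"; §8.1 p. 29, `‖h‖_{U,g,2}`).
[cite: PastenShimura2024, §4.6 p. 15 and §8.1 p. 29] -/
def peterssonNormSq (F : Set ℍ) (h : ℍ → ℂ) : ℝ :=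
  ∫ z in F, ‖h z‖ ^ 2 * z.im ^ 2

/-- `‖h‖²_F ≥ 0`. [folklore] -/
theorem peterssonNormSq_nonneg (F : Set ℍ) (h : ℍ → ℂ) : 0 ≤ peterssonNormSq F h :=
  integral_nonneg fun z => by positivity

/-- `‖h‖²_{U₀^D(M),2}` on the datum's fundamental domain (Pasten §8.1 p. 29). [cite: PastenShimura2024, §8.1 p. 29] -/
def ShimuraCurveData.normSq {D M : ℕ} (X : ShimuraCurveData D M) (h : ℍ → ℂ) : ℝ :=
  peterssonNormSq X.fd h

/-- `‖h‖_{U₀^D(M),2} = (‖h‖²)^{1/2}` (Pasten §8.1 p. 29). [cite: PastenShimura2024, §8.1 p. 29] -/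
def ShimuraCurveData.norm {D M : ℕ} (X : ShimuraCurveData D M) (h : ℍ → ℂ) : ℝ :=
  Real.sqrt (X.normSq h)

/-- The **supremum norm** `‖h‖_{U,g,∞} = sup_{z ∈ ℍ} |h(z)| Im(z)` of a weight-two form
(Pasten §8.1 p. 29); junk value `0` if `|h| Im` is unbounded (`Real.iSup`).
[cite: PastenShimura2024, §8.1 p. 29] -/
def hypSupNorm (h : ℍ → ℂ) : ℝ :=
  ⨆ z : ℍ, ‖h z‖ * z.im

/-! ### Periods -/

/-- `∫_z^w s(τ) dτ` along the straight segment from `z` to `w` (`ℍ` is convex; for holomorphic `s`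
this is the path integral along any path in `ℍ`). [folklore] -/
def segmentIntegral (s : ℍ → ℂ) (z w : ℍ) : ℂ :=
  ∫ t in (0 : ℝ)..1,
    s (UpperHalfPlane.ofComplex ((1 - (t : ℂ)) * (z : ℂ) + (t : ℂ) * (w : ℂ))) * ((w : ℂ) - (z : ℂ))

/-- **The periods of `s` on `Γ` lie in `Λ`**: `∫_z^{γz} s(τ) dτ ∈ Λ` for all `γ ∈ Γ`, `z ∈ ℍ`
(for a weight-`2` form, `γ ↦ ∫_z^{γz} s` is a homomorphism `Γ → ℂ` independent of `z`; the
condition says that `τ ↦ ∫_{z₀}^τ s mod Λ` descends to a holomorphic map `Γ\ℍ → ℂ/Λ`).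
[folklore] -/
def HasPeriodsIn (Γ : Subgroup (GL (Fin 2) ℝ)) (s : ℍ → ℂ) (Λ : Set ℂ) : Prop :=
  ∀ γ ∈ Γ, ∀ z : ℍ, segmentIntegral s z (γ • z) ∈ Λ

/-! ### Hecke operators on `S₂^D(M)` -/

namespace ShimuraCurveData

variable {D M : ℕ} (X : ShimuraCurveData D M)

/-- `ι(O(n)) ⊆ GL(2, ℝ)`: the matrices `ι(x)`, `x ∈ O`, of determinant (= reduced norm) `n`
(Shimura 1971 §3.3 `Δ`; Eichler). [folklore] -/
def heckeSet (n : ℕ) : Set (GL (Fin 2) ℝ) :=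
  {g | (∃ x ∈ X.O, X.ι x = (g : Matrix (Fin 2) (Fin 2) ℝ)) ∧ (g : Matrix (Fin 2) (Fin 2) ℝ).det = n}

/-- Left `Γ₀^D(M)`-cosets on `ι(O(n))`: `α ∼ α'` iff `α' = γ α`, `γ ∈ Γ` (`Γ ι(O(n)) ⊆ ι(O(n))`
because `O` is a ring). [folklore] -/
def heckeSetoid (n : ℕ) : Setoid (X.heckeSet n) where
  r a a' := ∃ γ ∈ X.Gamma, γ * (a : GL (Fin 2) ℝ) = a'
  iseqv :=
    { refl := fun a => ⟨1, one_mem _, one_mul _⟩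
      symm := fun {a a'} ⟨γ, hγ, h⟩ => ⟨γ⁻¹, inv_mem hγ, by rw [← h, inv_mul_cancel_left]⟩
      trans := fun {a a' a''} ⟨γ, hγ, h⟩ ⟨γ', hγ', h'⟩ =>
        ⟨γ' * γ, mul_mem hγ' hγ, by rw [mul_assoc, h, h']⟩ }

/-- **The Hecke operator `T_n` on weight-two forms for `Γ₀^D(M)`**:
`(T_n h)(τ) = Σ_{[α] ∈ Γ\ι(O(n))} (h ∣[2] α)(τ)`, Mathlib's slash action
`(h ∣[2] α)(τ) = det(α) j(α, τ)⁻² h(ατ)` (so this is the arithmetically normalised `T_n`,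
`= n Σ j(α,τ)⁻² h(ατ)`; Shimura 1971 (3.3.?)/Thm 3.24 normalisation, for which the transfer of a
normalised newform has `T_ℓ`-eigenvalue `a_ℓ`). Pasten §4.8 p. 15 (`T_{U,n}`, `n` coprime to
`D m`, acting on `H⁰(X_U, Ω¹) ≅ S_U` by pull-back and trace) is this operator under `Ψ_U`.
A `finsum` over `Quotient.out` representatives: for `h` invariant under `Γ` in weight `2` the
summands do not depend on the representatives, and the coset space is finite (finitely many
integral left `O`-ideals of norm `n`), so no junk value occurs on `S₂^D(M)`. [cite: PastenShimura2024, §4.8 p. 15 (Hecke action)] -/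
def heckeFun (n : ℕ) (h : ℍ → ℂ) : ℍ → ℂ := fun τ =>
  ∑ᶠ q : Quotient (X.heckeSetoid n), (h ∣[(2 : ℤ)] ((q.out : X.heckeSet n) : GL (Fin 2) ℝ)) τ

end ShimuraCurveData

/-! ### Shimura-curve parametrisations of an elliptic curve -/

/-- **Shimura-curve parametrisation data** of the Weierstrass curve `W/ℚ` by `X₀^D(M)` — a
hypothesis structure mirroring `ModularParametrizationData` (`ModularCurve.lean`): a period pair `L`
spanning the lattice of the invariant differential `ω = dx/(2y + a₁x + a₃)` of the model `W`
(`IsNeronLatticeOf`; the Néron lattice when `W` is globally minimal), the complex uniformisation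
`uniformize : ℂ →+ W(ℂ)` with kernel `Λ_L`, onto, given off `Λ_L` by `℘, ℘'` (honest fields, as
there), and a holomorphic map `φ : Γ₀^D(M)\ℍ → W(ℂ) = ℂ/Λ_L` recorded by: its pulled-back form
`form ∈ S₂^D(M)` (`φ^•(du) = form(τ) dτ`, Pasten §4.6 `Ψ_U`), a base point `τ₀`
(`φ(τ) = uniformize (∫_{τ₀}^τ form)`), the period condition (so `φ` is well defined on `Γ\ℍ`), the
**Hecke condition** `T_ℓ form = a_ℓ(W) form` for all primes `ℓ ∤ D M` (Mathlib
`WeierstrassCurve.LFunction`; it places `form` in the Jacquet–Langlands line of the newform of `W`,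
Pasten §4.9–4.11, multiplicity one), and the **degree** `deg > 0`: all but finitely many
`P ∈ W(ℂ)` have exactly `deg` preimage `Γ`-orbits. Pasten's `φ_{D,M,n} = q ∘ j_{D,M,n}` (§5.3
p. 17, over `ℚ`) and `q ∘ j_{p₀}` (proof of Prop. 5.1, over `ℂ`, of degree `δ_{D,M}`) composed with
an isogeny to `W` give such data. [cite: PastenShimura2024, §5.2–5.3 p. 17 (Shimura curve parameterizations)] -/
structure ShimuraParametrizationData {D M : ℕ} (X : ShimuraCurveData D M)
    (W : WeierstrassCurve ℚ) where
  /-- A period pair spanning the lattice of the invariant differential of the model `W`. -/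
  L : PeriodPair
  /-- `g₂(L) = c₄/12`, `g₃(L) = c₆/216` for `W` base-changed to `ℂ`. -/
  isNeronLattice : IsNeronLatticeOf (W.baseChange ℂ) L
  /-- The complex uniformisation `ℂ → ℂ/Λ_L ≃ W(ℂ)` as a group homomorphism. -/
  uniformize : ℂ →+ (W.baseChange ℂ).toAffine.Point
  /-- The kernel of the uniformisation is the lattice. -/
  ker_uniformize : (uniformize.ker : Set ℂ) = L.lattice
  /-- The uniformisation is onto `W(ℂ)`. -/
  uniformize_surjective : Function.Surjective uniformize
  /-- Off the lattice the uniformisation is `z ↦ (℘(z) − b₂/12, (℘'(z) − a₁x − a₃)/2)`. -/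
  uniformize_spec : ∀ z ∉ L.lattice, ∃ h,
    uniformize z = .some (W' := (W.baseChange ℂ).toAffine)
      (L.weierstrassP z - (W.baseChange ℂ).b₂ / 12)
      ((L.derivWeierstrassP z - (W.baseChange ℂ).a₁ * (L.weierstrassP z - (W.baseChange ℂ).b₂ / 12)
        - (W.baseChange ℂ).a₃) / 2) h
  /-- The weight-two form `φ^•(du)` on `Γ₀^D(M)`. -/
  form : CuspForm X.Gamma 2
  /-- The base point `τ₀` of the parametrisation. -/
  basePoint : ℍ
  /-- The periods of `form` lie in `Λ_L` (`φ` descends to `Γ\ℍ`). -/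
  period_mem : HasPeriodsIn X.Gamma form (L.lattice : Set ℂ)
  /-- `form` is a Hecke eigenform with the eigenvalues of `W` away from `D M`. -/
  hecke_eq : ∀ ℓ : ℕ, ℓ.Prime → ¬ ℓ ∣ D * M →
    X.heckeFun ℓ form = fun τ => ((W.LFunction ℓ : ℤ) : ℂ) * form τ
  /-- The degree of the parametrisation. -/
  deg : ℕ
  /-- The degree is positive (the parametrisation is non-constant). -/
  deg_pos : 0 < deg
  /-- All but finitely many `P ∈ W(ℂ)` have exactly `deg` orbits `Γτ` with
  `uniformize (∫_{τ₀}^τ form) = P`. -/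
  deg_spec : {P : (W.baseChange ℂ).toAffine.Point |
    Nat.card {y : MulAction.orbitRel.Quotient X.Gamma ℍ // ∃ τ : ℍ,
      (Quotient.mk _ τ : MulAction.orbitRel.Quotient X.Gamma ℍ) = y ∧
        uniformize (segmentIntegral form basePoint τ) = P} ≠ deg}.Finite

namespace ShimuraParametrizationData

variable {D M : ℕ} {X : ShimuraCurveData D M} {W : WeierstrassCurve ℚ}
  (P : ShimuraParametrizationData X W)

/-- **The parametrisation** `φ : ℍ → W(ℂ)`, `φ(τ) = uniformize (∫_{τ₀}^τ form)`; constant on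
`Γ`-orbits by `period_mem`, so it is the map `X₀^D(M)(ℂ) → W(ℂ)` (Pasten §5.3). [cite: PastenShimura2024, §5.3 p. 17] -/
def φ (τ : ℍ) : (W.baseChange ℂ).toAffine.Point :=
  P.uniformize (segmentIntegral P.form P.basePoint τ)

/-- The kernel of the uniformisation is the lattice (membership form). [folklore] -/
theorem uniformize_eq_zero_iff (z : ℂ) : P.uniformize z = 0 ↔ z ∈ P.L.lattice := by
  rw [← SetLike.mem_coe, ← P.ker_uniformize, SetLike.mem_coe, AddMonoidHom.mem_ker]

end ShimuraParametrizationData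

end Literature.NumberTheory.Automorphic

end
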